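import Literature.NumberTheory.Rogawski1990.FlickerLiteralEigenframes        -- ★ frames `P₁`, `D_π P₁`: `flickerFrame(Pi)_mul_inv`, `flickerFrame(Pi)Inv_mul`, `literal_one∕pi_eq_conj_diagonal`, `gram_flickerFrame(_pi)`
import Literature.NumberTheory.Automorphic.SplitTorusCayleyShiftValued        -- ★ `exists_mem_unitaryGroupOfForm_coe_eq_conj_diagonal` (`P·diag(Y)·P⁻¹ ∈ U(σ, Φ)` from the Gram matrix of `P`)
import Literature.NumberTheory.Automorphic.HermitianLatticesLocal             -- ★ `LocalConjDatum` (`σσ`, `vσ`, `σϖ`, `vϖ`, `v2`)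
import Summits.HodgeConjecture.HodgeConjecture.Theorems.R90S6FlickerLiteralRegimes   -- ★ p09 `flickerLiteral_norm_one_letters` (`σa·a = 1 ⟹ |a| = 1`)
import HarnessLib

/-!
# R90 · S6 — LINE S1, REGIME R-II, CARD R2M (FILE 2, sibling): THE FLICKER LITERAL CALCULUS, ITS UNITARY LIFT, AND THE SHIFT LETTER `b′`
# (`Theorems/R90S6FlickerLiteralShiftUnit.lean`)

Cell `hodgecm-mathlib`, crux H413 (`stmt-HodgeConjecture-24833`), route of record `HCCMUnconditional`; programme R90-TF, section S6 (base `R90-C14`), seat R90-C14-p05 (g2);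
S6 dealer R90-C14-plan (g2) card R2M (2026-09-05T02:23:40Z), two-file cut «=» 02:31:48Z, (R2M.3) head shapes «=» 02:47:13Z.  Helper lane
`--supports stmt-HodgeConjecture-24833 --as helper`; THEOREMS ONLY (no definition, no instance, no notation, no named fact, no `sorry`).  This sibling feeds
`Theorems/R90S6TorusFixedSpecialCountTwoCongruentFlicker.lean` (the per-literal values of `a₁` in regime R-II), which instantiates ★ FILE 1
`natCard_fixedBy_special_eq_one_add_mul_natCard_fixedBy_of_mem_adjoin` at an explicit unit `Y` of the shifted order.

THE MATHEMATICS [Flicker1998UnitaryFL, §2 Prop. 3 pp. 78–79, §3 p. 80; Kottwitz1986BaseChangeUnits, §1 pp. 240–241; Rogawski1990, §4.9 p. 55].  Flicker's literal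
`T_θ(x, y, z) = (e(x+z) 0 −e(x−z)θ; 0 y 0; −e(x−z)θ′ 0 e(x+z))` (`2e = 1`, `θθ′ = 1`) is `P_θ · diag(x, y, z) · P_θ⁻¹` for the FIXED frame `P_θ`, hence (§1) it is a ring
homomorphism in `(x, y, z)`: `T − s·1 = T(x−s, y−s, z−s)`, `T(x,y,z)·T(x′,y′,z′) = T(xx′, yy′, zz′)`, `s·T = T(sx, sy, sz)`, `T + T′ = T(x+x′, …)`; (§2) for norm-one
`x, y, z` (and `σe = e`, `σθ = θ`) it is a UNITARY element: `∃ Y ∈ U(σ, J₀)(K)` with matrix `T_θ(x,y,z)` (★ `exists_mem_unitaryGroupOfForm_coe_eq_conj_diagonal` on the ★ Gram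
matrices of the frames); (§3) THE SHIFT LETTER: for norm-one `a, c` with `|a − c| = 1` and a depth `n ≥ 1` there is a norm-one `b′` with `|a − b′| = |ϖ^{n−1}|` and `|c − b′| = 1`
(`n ≥ 2`: `b′ = a·z∕σz`, `z = 1 + ϖ^{n−1}a₀` for the frame element `a₀` with `σa₀ − a₀` a unit; `n = 1`: `b′ = −a`, or `a·z∕σz` with `z = 1 + a₀` or `2 + a₀`) — the eigenvalue
that replaces `b` in the Möbius∕Cayley shift `Y = T_θ(a, b′, c)` of `γ = T_θ(a, b, c)` ONE LEVEL DOWN.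
HONEST LABEL: matrix identities and one valuation-theoretic existence statement; count-neutral; proves no printed statement.  HC_CM is proved only modulo the 7 printed citations
(2 remaining named inputs: hLiu418 = stmt-HodgeConjecture-24832, h413 = stmt-HodgeConjecture-24833) until rung 0 closes.

## References
* [Flicker1998UnitaryFL] Y. Z. Flicker, *Elementary proof of the fundamental lemma for a unitary group*, Canad. J. Math. 50 (1998) 74–98, §2 Prop. 3 pp. 78–79, §3 p. 80.
* [Kottwitz1986BaseChangeUnits] R. E. Kottwitz, *Base change for unit elements of Hecke algebras*, Compositio Math. 60 (1986) 237–250, §1 pp. 240–241.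
* [Rogawski1990] J. D. Rogawski, *Automorphic Representations of Unitary Groups in Three Variables*, Ann. of Math. Stud. 123 (1990), §4.9 p. 55.
-/

set_option autoImplicit false
-- the mandated namespace repeats the single-problem summit's segment (`HodgeConjecture.HodgeConjecture`)
set_option linter.dupNamespace false

noncomputable section

open Matrix
open Literature.NumberTheory.Automorphic Literature.NumberTheory.Automorphic.HermitianLattice Literature.NumberTheory.Automorphic.UnitaryGroup
open Literature.NumberTheory.Rogawski1990.Flicker1998
open scoped Matrix MatrixGroups WithZero Valued

namespace Summit.HodgeConjecture.HodgeConjecture.R90.S6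

/-! ### §1 The literal `T_θ(x, y, z)` is a ring homomorphism in `(x, y, z)` -/

section Ring

variable {R : Type*} [CommRing R]

/-- `T_θ(x,y,z) − s·1 = T_θ(x−s, y−s, z−s)` (`2e = 1`). [cite: Flicker1998UnitaryFL, §2 Prop. 3 pp. 78–79] -/
theorem flickerLiteral_sub_smul_one {e : R} (h2e : 2 * e = 1) (θ θ' x y z s : R) :
    !![e * (x + z), 0, -(e * (x - z) * θ); 0, y, 0; -(e * (x - z) * θ'), 0, e * (x + z)] - s • (1 : Matrix (Fin 3) (Fin 3) R) =
      !![e * ((x - s) + (z - s)), 0, -(e * ((x - s) - (z - s)) * θ); 0, y - s, 0; -(e * ((x - s) - (z - s)) * θ'), 0, e * ((x - s) + (z - s))] := by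
  ext i j
  fin_cases i <;> fin_cases j <;> simp <;> linear_combination s * h2e

/-- `T_θ(x,y,z) · T_θ(x′,y′,z′) = T_θ(xx′, yy′, zz′)` (`2e = 1`, `θθ′ = 1`): the three eigenlines are common. [cite: Flicker1998UnitaryFL, §2 Prop. 3 pp. 78–79] -/
theorem flickerLiteral_mul_flickerLiteral {e θ θ' : R} (h2e : 2 * e = 1) (hθ : θ * θ' = 1) (x y z x' y' z' : R) :
    !![e * (x + z), 0, -(e * (x - z) * θ); 0, y, 0; -(e * (x - z) * θ'), 0, e * (x + z)] *
        !![e * (x' + z'), 0, -(e * (x' - z') * θ); 0, y', 0; -(e * (x' - z') * θ'), 0, e * (x' + z')] =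
      !![e * (x * x' + z * z'), 0, -(e * (x * x' - z * z') * θ); 0, y * y', 0; -(e * (x * x' - z * z') * θ'), 0, e * (x * x' + z * z')] := by
  ext i j
  fin_cases i <;> fin_cases j <;> simp [Matrix.mul_apply, Fin.sum_univ_three] <;> grind

/-- `s · T_θ(x,y,z) = T_θ(sx, sy, sz)`. [cite: Flicker1998UnitaryFL, §2 Prop. 3 pp. 78–79] -/
theorem smul_flickerLiteral (e θ θ' x y z s : R) :
    s • !![e * (x + z), 0, -(e * (x - z) * θ); 0, y, 0; -(e * (x - z) * θ'), 0, e * (x + z)] =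
      !![e * (s * x + s * z), 0, -(e * (s * x - s * z) * θ); 0, s * y, 0; -(e * (s * x - s * z) * θ'), 0, e * (s * x + s * z)] := by
  ext i j
  fin_cases i <;> fin_cases j <;> simp <;> ring

/-- `T_θ(x,y,z) + T_θ(x′,y′,z′) = T_θ(x+x′, y+y′, z+z′)`. [cite: Flicker1998UnitaryFL, §2 Prop. 3 pp. 78–79] -/
theorem flickerLiteral_add_flickerLiteral (e θ θ' x y z x' y' z' : R) :
    !![e * (x + z), 0, -(e * (x - z) * θ); 0, y, 0; -(e * (x - z) * θ'), 0, e * (x + z)] +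
        !![e * (x' + z'), 0, -(e * (x' - z') * θ); 0, y', 0; -(e * (x' - z') * θ'), 0, e * (x' + z')] =
      !![e * ((x + x') + (z + z')), 0, -(e * ((x + x') - (z + z')) * θ); 0, y + y', 0; -(e * ((x + x') - (z + z')) * θ'), 0, e * ((x + x') + (z + z'))] := by
  ext i j
  fin_cases i <;> fin_cases j <;> simp <;> ring

/-- The `θ = 1` literal is the `θ = θ′ = 1` instance of `T_θ`. [cite: Flicker1998UnitaryFL, §2 Prop. 3 pp. 78–79] -/
theorem flickerLiteral_one_eq (e x y z : R) :
    !![e * (x + z), 0, -(e * (x - z)); 0, y, 0; -(e * (x - z)), 0, e * (x + z)] =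
      !![e * (x + z), 0, -(e * (x - z) * 1); 0, y, 0; -(e * (x - z) * 1), 0, e * (x + z)] := by
  simp only [mul_one]

end Ring

/-! ### §2 The literal with norm-one entries is a unitary element -/

section Unitary

variable {K : Type*} [Field K]

/-- `Φ₃` written as `(i, j) ↦ [i + j + 1 = 3]` is `(StdForm.antidiagonal 3).over K` (★ `UnitaryGroup.antidiagOne_eq_over`, here at any universe; adapted from ★
`K2E3WittCartanUnramified.antidiagOne_eq_over'`). [cite: Rogawski1990, §1.9 p. 8] -/
theorem antidiagOne_three_eq_over :
    (Matrix.of fun i j : Fin 3 => if i.val + j.val + 1 = 3 then (1 : K) else 0) = (StdForm.antidiagonal 3).over K := by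
  ext i j
  have hiff : i.val + j.val + 1 = 3 ↔ j = i.rev := by
    rw [Fin.ext_iff, Fin.val_rev]
    omega
  simp only [StdForm.over, Matrix.map_apply, StdForm.antidiagonal_J_apply, Matrix.of_apply]
  by_cases hij : j = i.rev
  · rw [if_pos (hiff.2 hij), if_pos hij, map_one]
  · rw [if_neg (fun h' => hij (hiff.1 h')), if_neg hij, map_zero]

/-- **`T_π(x, y, z) ∈ U(σ, J₀)(K)` for norm-one `x, y, z`** (`2e = 1`, `ππ′ = 1`, `σπ = π`): the unitary element with matrix `T_π(x,y,z) = (D_π P₁)·diag(x,y,z)·(D_π P₁)⁻¹`, from the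
★ Gram matrix `diag(−2π, 1, 2π)` of the frame (★ `exists_mem_unitaryGroupOfForm_coe_eq_conj_diagonal`). [cite: Flicker1998UnitaryFL, §2 Prop. 3 pp. 78–79; §3 p. 80] -/
theorem exists_unitary_coe_eq_flickerLiteral_pi (σ : K →+* K) {e π π' : K} (h2e : 2 * e = 1) (hππ : π * π' = 1) (hσπ : σ π = π)
    {x y z : K} (hx : σ x * x = 1) (hy : σ y * y = 1) (hz : σ z * z = 1) :
    ∃ Y : ↥(unitaryGroupOfForm σ ((StdForm.antidiagonal 3).over K)),
      ((Y : GL (Fin 3) K) : Matrix (Fin 3) (Fin 3) K) = !![e * (x + z), 0, -(e * (x - z) * π); 0, y, 0; -(e * (x - z) * π'), 0, e * (x + z)] := by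
  -- the frame `D_π P₁` as a `GL₃` element with its explicit inverse
  let P : GL (Fin 3) K :=
    ⟨!![π, 0, 0; 0, 1, 0; 0, 0, 1] * !![(1 : K), 0, 1; 0, 1, 0; -1, 0, 1], !![e, 0, -e; 0, 1, 0; e, 0, e] * !![π', 0, 0; 0, 1, 0; 0, 0, 1],
      flickerFramePi_mul_inv h2e hππ, flickerFramePiInv_mul h2e hππ⟩
  have hG : ((P : Matrix (Fin 3) (Fin 3) K).map σ)ᵀ * (StdForm.antidiagonal 3).over K * (P : Matrix (Fin 3) (Fin 3) K) = diagonal ![-2 * π, 1, 2 * π] := by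
    rw [← antidiagOne_three_eq_over]
    change ((!![π, 0, 0; 0, 1, 0; 0, 0, 1] * !![(1 : K), 0, 1; 0, 1, 0; -1, 0, 1]).map σ)ᵀ * _ * (!![π, 0, 0; 0, 1, 0; 0, 0, 1] * !![(1 : K), 0, 1; 0, 1, 0; -1, 0, 1]) = _
    rw [gram_flickerFrame_pi σ hσπ, ← Literature.NumberTheory.Rogawski1990.Flicker1998.diagonal_fin_three]
  have hY : ∀ i, σ (![x, y, z] i) * ![x, y, z] i = 1 := by
    intro i; fin_cases i
    · exact hx
    · exact hy
    · exact hz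
  obtain ⟨g, hg, hcoe⟩ := exists_mem_unitaryGroupOfForm_coe_eq_conj_diagonal σ ((StdForm.antidiagonal 3).over K) P hG hY
  refine ⟨⟨g, hg⟩, ?_⟩
  change (g : Matrix (Fin 3) (Fin 3) K) = _
  rw [hcoe, literal_pi_eq_conj_diagonal hππ x y z, Literature.NumberTheory.Rogawski1990.Flicker1998.diagonal_fin_three]
  rfl

/-- **`T_1(x, y, z) ∈ U(σ, J₀)(K)` for norm-one `x, y, z`** (`2e = 1`): the unitary element with matrix `T_1(x,y,z) = P₁·diag(x,y,z)·P₁⁻¹`, from the ★ Gram matrix `diag(−2, 1, 2)` of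
`P₁` (★ `exists_mem_unitaryGroupOfForm_coe_eq_conj_diagonal`). [cite: Flicker1998UnitaryFL, §2 Prop. 3 pp. 78–79] -/
theorem exists_unitary_coe_eq_flickerLiteral_one (σ : K →+* K) {e : K} (h2e : 2 * e = 1) {x y z : K} (hx : σ x * x = 1) (hy : σ y * y = 1) (hz : σ z * z = 1) :
    ∃ Y : ↥(unitaryGroupOfForm σ ((StdForm.antidiagonal 3).over K)),
      ((Y : GL (Fin 3) K) : Matrix (Fin 3) (Fin 3) K) = !![e * (x + z), 0, -(e * (x - z)); 0, y, 0; -(e * (x - z)), 0, e * (x + z)] := by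
  let P : GL (Fin 3) K := ⟨!![(1 : K), 0, 1; 0, 1, 0; -1, 0, 1], !![e, 0, -e; 0, 1, 0; e, 0, e], flickerFrame_mul_inv h2e, flickerFrameInv_mul h2e⟩
  have hG : ((P : Matrix (Fin 3) (Fin 3) K).map σ)ᵀ * (StdForm.antidiagonal 3).over K * (P : Matrix (Fin 3) (Fin 3) K) = diagonal ![(-2 : K), 1, 2] := by
    rw [← antidiagOne_three_eq_over]
    change ((!![(1 : K), 0, 1; 0, 1, 0; -1, 0, 1]).map σ)ᵀ * _ * !![(1 : K), 0, 1; 0, 1, 0; -1, 0, 1] = _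
    rw [gram_flickerFrame σ, ← Literature.NumberTheory.Rogawski1990.Flicker1998.diagonal_fin_three]
  have hY : ∀ i, σ (![x, y, z] i) * ![x, y, z] i = 1 := by
    intro i; fin_cases i
    · exact hx
    · exact hy
    · exact hz
  obtain ⟨g, hg, hcoe⟩ := exists_mem_unitaryGroupOfForm_coe_eq_conj_diagonal σ ((StdForm.antidiagonal 3).over K) P hG hY
  refine ⟨⟨g, hg⟩, ?_⟩
  change (g : Matrix (Fin 3) (Fin 3) K) = _
  rw [hcoe, literal_one_eq_conj_diagonal e x y z, Literature.NumberTheory.Rogawski1990.Flicker1998.diagonal_fin_three]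
  rfl

end Unitary

/-! ### §3 The shift letter `b′`: a norm-one eigenvalue one level down -/

section Shift

variable {K : Type*} [Field K] [Valued K ℤᵐ⁰] {σ : K →+* K} {ϖ : K}

omit [Valued K ℤᵐ⁰] in
/-- **The quotient `z ∕ σz` is a norm-one element** (`σ` an involution, `z ≠ 0`): `σ(z∕σz)·(z∕σz) = 1`. [cite: Rogawski1990, §4.9 p. 55] -/
theorem normOne_div_map (hσσ : ∀ x, σ (σ x) = x) {z : K} (hz : z ≠ 0) : σ (z / σ z) * (z / σ z) = 1 := by
  have hσz : σ z ≠ 0 := fun h => hz (by rw [← hσσ z, h, map_zero])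
  rw [map_div₀, hσσ, div_mul_div_comm, mul_comm (σ z) z, div_self (mul_ne_zero hz hσz)]

/-- **The frame element's antitrace is a unit**: `|a₀ − σa₀| = 1`, read off `ha₀`. [cite: Rogawski1990, §4.9 p. 55] -/
theorem v_sub_map_eq_one_of_isUnit (hσO : ∀ y : 𝒪[K], (σ.comp 𝒪[K].subtype) y ∈ 𝒪[K])
    {a₀ : 𝒪[K]} (ha₀ : IsUnit (((σ.comp 𝒪[K].subtype).codRestrict 𝒪[K] hσO) a₀ - a₀)) :
    Valued.v ((a₀ : K) - σ (a₀ : K)) = 1 := by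
  have h := (Valuation.integer.integers (Valued.v (R := K))).isUnit_iff_valuation_eq_one.1 ha₀
  rw [← Valuation.map_neg, neg_sub]
  exact h

/-- `|k + a₀| = 1` for a `σ`-fixed unit `k` (`σk = k`, `|k| ≤ 1`): otherwise `a₀ ≡ −k ≡ σa₀`, contradicting `|a₀ − σa₀| = 1`. [cite: Rogawski1990, §4.9 p. 55] -/
theorem v_add_eq_one_of_antitrace (hσv : ∀ x, Valued.v (σ x) = Valued.v x) {k a₀ : K} (hσk : σ k = k) (hk : Valued.v k ≤ 1) (ha₀ : Valued.v a₀ ≤ 1)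
    (hanti : Valued.v (a₀ - σ a₀) = 1) : Valued.v (k + a₀) = 1 := by
  have hle : Valued.v (k + a₀) ≤ 1 := Valuation.map_add_le _ hk ha₀
  refine le_antisymm hle (not_lt.1 fun hlt => ?_)
  have hlt' : Valued.v (σ (k + a₀)) < 1 := by rw [hσv]; exact hlt
  rw [map_add, hσk] at hlt'
  have e : a₀ - σ a₀ = (k + a₀) - (k + σ a₀) := by ring
  have := Valuation.map_sub_lt _ hlt hlt'
  rw [← e, hanti] at this
  exact lt_irrefl _ this

/-- **THE SHIFT LETTER.**  `σ` an isometric involution fixing `ϖ` (`|ϖ| = exp(−1)`, `|2| = 1`), `a₀ ∈ 𝒪` with `σa₀ − a₀` a unit (the frame element of the ★ unit counts), `a, c` norm-one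
with `|a − c| = 1`, and `n ≥ 1`: there is a norm-one `b′` with `|a − b′| = |ϖ^{n−1}|` and `|c − b′| = 1` — the eigenvalue ONE LEVEL DOWN.  For `n ≥ 2`: `b′ = a·z∕σz`,
`z = 1 + ϖ^{n−1}a₀` (`z − σz = ϖ^{n−1}(a₀ − σa₀)`); for `n = 1`: `b′ = −a` if `|a + c| = 1`, else `b′ = a·z∕σz` with `z = 1 + a₀` or `z = 2 + a₀` (one of `z + σz = 2(k + ½(a₀+σa₀))`,
`k = 1, 2`, is a unit since they differ by `2`). [cite: Kottwitz1986BaseChangeUnits, §1 pp. 240–241] [cite: Rogawski1990, §4.9 p. 55] -/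
theorem exists_normOne_shift (hd : LocalConjDatum σ ϖ) (hσO : ∀ y : 𝒪[K], (σ.comp 𝒪[K].subtype) y ∈ 𝒪[K])
    {a₀ : 𝒪[K]} (ha₀ : IsUnit (((σ.comp 𝒪[K].subtype).codRestrict 𝒪[K] hσO) a₀ - a₀))
    {a c : K} (ha : σ a * a = 1) (hc : σ c * c = 1) (hac : Valued.v (a - c) = 1) {n : ℕ} (hn : 1 ≤ n) :
    ∃ b' : K, σ b' * b' = 1 ∧ Valued.v (a - b') = Valued.v (ϖ ^ (n - 1)) ∧ Valued.v (c - b') = 1 := by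
  have hva : Valued.v a = 1 := (flickerLiteral_norm_one_letters σ hd.vσ ha).2
  have hvc : Valued.v c = 1 := (flickerLiteral_norm_one_letters σ hd.vσ hc).2
  have ha0 : a ≠ 0 := fun h => by rw [h, map_zero] at hva; exact zero_ne_one hva
  have hanti : Valued.v ((a₀ : K) - σ (a₀ : K)) = 1 := v_sub_map_eq_one_of_isUnit hσO ha₀
  have ha₀1 : Valued.v (a₀ : K) ≤ 1 := a₀.2
  have hσa₀1 : Valued.v (σ (a₀ : K)) ≤ 1 := by rw [hd.vσ]; exact ha₀1
  have h2 : Valued.v (2 : K) = 1 := hd.v2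
  -- the quotient construction `b′ = a·z∕σz` for a unit `z`
  have key : ∀ z : K, Valued.v z = 1 →
      σ (a * (z / σ z)) * (a * (z / σ z)) = 1 ∧ Valued.v (a - a * (z / σ z)) = Valued.v (z - σ z) ∧
        c - a * (z / σ z) = (c - a) + a * ((σ z - z) / σ z) ∧ c - a * (z / σ z) = (c + a) - a * ((z + σ z) / σ z) := by
    intro z hz1
    have hz0 : z ≠ 0 := fun h => by rw [h, map_zero] at hz1; exact zero_ne_one hz1
    have hσz1 : Valued.v (σ z) = 1 := by rw [hd.vσ]; exact hz1
    have hσz0 : σ z ≠ 0 := fun h => by rw [h, map_zero] at hσz1; exact zero_ne_one hσz1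
    refine ⟨?_, ?_, ?_, ?_⟩
    · rw [map_mul, mul_mul_mul_comm, ha, one_mul]; exact normOne_div_map hd.σσ hz0
    · have e : a - a * (z / σ z) = a * ((σ z - z) / σ z) := by field_simp
      rw [e, map_mul, hva, one_mul, map_div₀, hσz1, div_one, Valuation.map_sub_swap]
    · field_simp; ring
    · field_simp; ring
  rcases Nat.lt_or_ge 1 n with hn2 | hn1
  · -- `n ≥ 2`: `z = 1 + ϖ^{n−1} a₀`
    set z : K := 1 + ϖ ^ (n - 1) * (a₀ : K) with hz
    have hsmall : Valued.v (ϖ ^ (n - 1) * (a₀ : K)) < 1 := by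
      rw [map_mul]
      calc Valued.v (ϖ ^ (n - 1)) * Valued.v (a₀ : K) ≤ Valued.v (ϖ ^ (n - 1)) := mul_le_of_le_one_right' ha₀1
        _ < 1 := by
          rw [hd.v_pow, ← WithZero.exp_zero, WithZero.exp_lt_exp]
          omega
    have hz1 : Valued.v z = 1 := by
      rw [hz, Valuation.map_add_eq_of_lt_left _ (by rw [Valuation.map_one]; exact hsmall), Valuation.map_one]
    have hzσ : z - σ z = ϖ ^ (n - 1) * ((a₀ : K) - σ (a₀ : K)) := by
      rw [hz, map_add, map_one, map_mul, map_pow, hd.σϖ]; ring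
    have hvzσ : Valued.v (z - σ z) = Valued.v (ϖ ^ (n - 1)) := by rw [hzσ, map_mul, hanti, mul_one]
    obtain ⟨h1, h2', h3, -⟩ := key z hz1
    refine ⟨a * (z / σ z), h1, by rw [h2', hvzσ], ?_⟩
    rw [h3]
    have hca : Valued.v (c - a) = 1 := by rw [Valuation.map_sub_swap]; exact hac
    have hlt : Valued.v (a * ((σ z - z) / σ z)) < Valued.v (c - a) := by
      rw [hca, map_mul, hva, one_mul, map_div₀, hd.vσ, hz1, div_one, Valuation.map_sub_swap, hvzσ, hd.v_pow, ← WithZero.exp_zero, WithZero.exp_lt_exp]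
      omega
    rw [Valuation.map_add_eq_of_lt_left _ hlt, hca]
  · -- `n = 1`
    have hn1' : n = 1 := le_antisymm hn1 hn
    subst hn1'
    simp only [Nat.sub_self, pow_zero, Valuation.map_one]
    by_cases hsum : Valued.v (a + c) = 1
    · -- `b′ = −a`
      refine ⟨-a, by rw [map_neg, neg_mul_neg, ha], ?_, ?_⟩
      · rw [sub_neg_eq_add, ← two_mul, map_mul, h2, hva, one_mul]
      · rw [sub_neg_eq_add, add_comm]; exact hsum
    · -- `|a + c| < 1`: `b′ = a·z∕σz` with `z = k + a₀`, `k ∈ {1, 2}`, `|z + σz| = 1`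
      have hsum' : Valued.v (a + c) < 1 := lt_of_le_of_ne (Valuation.map_add_le _ hva.le hvc.le) hsum
      -- choose `k`
      obtain ⟨k, hσk, hk1, hksum⟩ : ∃ k : K, σ k = k ∧ Valued.v k ≤ 1 ∧ Valued.v ((k + (a₀ : K)) + σ (k + (a₀ : K))) = 1 := by
        have hσ1 : σ (1 : K) = 1 := map_one σ
        have hσ2 : σ (2 : K) = 2 := map_ofNat σ 2
        by_cases h1 : Valued.v (((1 : K) + (a₀ : K)) + σ ((1 : K) + (a₀ : K))) = 1
        · exact ⟨1, hσ1, by rw [Valuation.map_one], h1⟩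
        · refine ⟨2, hσ2, h2.le, ?_⟩
          have hle1 : Valued.v (((1 : K) + (a₀ : K)) + σ ((1 : K) + (a₀ : K))) ≤ 1 :=
            Valuation.map_add_le _ (Valuation.map_add_le _ (by rw [Valuation.map_one]) ha₀1) (by rw [hd.vσ]; exact Valuation.map_add_le _ (by rw [Valuation.map_one]) ha₀1)
          have hlt1 : Valued.v (((1 : K) + (a₀ : K)) + σ ((1 : K) + (a₀ : K))) < 1 := lt_of_le_of_ne hle1 h1
          have e : ((2 : K) + (a₀ : K)) + σ ((2 : K) + (a₀ : K)) = 2 + (((1 : K) + (a₀ : K)) + σ ((1 : K) + (a₀ : K))) := by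
            rw [map_add, map_add, hσ1, hσ2]; ring
          rw [e, Valuation.map_add_eq_of_lt_left _ (by rw [h2]; exact hlt1), h2]
      set z : K := k + (a₀ : K) with hz
      have hz1 : Valued.v z = 1 := v_add_eq_one_of_antitrace hd.vσ hσk hk1 ha₀1 hanti
      have hzσ : z - σ z = (a₀ : K) - σ (a₀ : K) := by rw [hz, map_add, hσk]; ring
      obtain ⟨h1, h2', -, h4⟩ := key z hz1
      refine ⟨a * (z / σ z), h1, by rw [h2', hzσ, hanti], ?_⟩
      rw [h4]
      have hσz1 : Valued.v (σ z) = 1 := by rw [hd.vσ]; exact hz1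
      have hbig : Valued.v (a * ((z + σ z) / σ z)) = 1 := by
        rw [map_mul, hva, one_mul, map_div₀, hσz1, div_one]; exact hksum
      rw [Valuation.map_sub_swap, sub_eq_add_neg, Valuation.map_add_eq_of_lt_left _ (by rw [Valuation.map_neg, hbig, add_comm]; exact hsum'), hbig]

end Shift

end Summit.HodgeConjecture.HodgeConjecture.R90.S6

end
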